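import Literature.AlgebraicGeometry.HodgeTheory.HodgeIndexSurfaceOneOne
import HarnessLib

/-!
# Real subspaces of `Hᵏ(X(ℂ); ℝ)` underlying conjugation-stable pieces of the Hodge decomposition

Voisin, *Hodge Theory and Complex Algebraic Geometry I*, §6.1.3 (Cor. 6.12 `conj H^{p,q} = H^{q,p}`, and
the remark after Cor. 6.13 that `H^{p,q} ⊕ H^{q,p}` for `p ≠ q` and `H^{p,p}` are "defined over `ℝ`",
i.e. complexifications of real sub-Hodge pieces), as dimension counts on the real cohomology of
`X(ℂ)` for `X` smooth projective of dimension `n`: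

* `mem_iff_reClass_imClass_of_conjClass_mem`: a `ℂ`-subspace `S ⊆ Hᵏ(X(ℂ); ℂ)` stable under complex
  conjugation is the complexification of `S_ℝ = {y | y ⊗ 1 ∈ S}`: `c ∈ S ↔ re c ⊗ 1 ∈ S ∧ im c ⊗ 1 ∈ S`,
  whence `dim_ℝ S_ℝ = dim_ℂ S` (`finrank_real_eq_of_conjClass_mem`);
* `finrank_real_eq_hodgeNumber_self`: `dim_ℝ H^{p,p}_ℝ = h^{p,p}` (any degree `k = 2p`, any `n`);
* `finrank_real_eq_two_mul_hodgeNumber`: `dim_ℝ (H^{p,q} ⊕ H^{q,p})_ℝ = 2 h^{p,q}` for `p ≠ q` (the two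
  pieces are independent summands of the Hodge decomposition, `isInternal_typePiece`, and
  `h^{q,p} = h^{p,q}`, `finrank_hodgePQ_symm`);
* `cupProduct_eq_zero_of_types_middle`, `cupProduct_eq_zero_of_mem_typePiece_sup`,
  `cupProduct_real_eq_zero_of_mem_typePiece_sup`: in the middle degree `n`, `H^{p,q} ⌣ H^{p',q'} = 0`
  unless `(p', q') = (q, p)`, so the blocks `H^{p,q} ⊕ H^{q,p}` — and their real forms, for the real cup
  pairing — are mutually orthogonal (Voisin I Lemma 7.30 / proof of Thm. 6.33).

These are the dimension counts of the real Hodge–Riemann blocks in the signature theorem (Voisin I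
Thm. 6.33, proof: "the signature is also equal to the signature of the Hermitian form … orthogonal
direct sum of the `L^r H^{a,b}_prim`"); the case `(p,q) = (1,1)`, `n = 2` is `finrank_realOneOne_eq`
of `HodgeIndexSurfaceOneOne.lean`.

## References

* C. Voisin, *Hodge Theory and Complex Algebraic Geometry I* (2002), §6.1.3 Cor. 6.12–6.13 and §6.3.2
  Thm. 6.33 (proof). [cite: VoisinHodgeI2002, §6.1.3 Cor. 6.12 and §6.3.2 Thm. 6.33]
-/

noncomputable section

open scoped Manifold ContDiff
open CategoryTheory AlgebraicGeometry Module Bundle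
open Literature.AlgebraicTopology.SingularHomology Literature.Geometry.Kaehler
open Literature.NumberTheory.Transcendental
open Literature.AlgebraicGeometry.Motives (IsSmoothProjective kaehlerFormPow)

namespace Literature.AlgebraicGeometry.HodgeTheory

section RealPieces

variable {n : ℕ} {X : Motives.SchemeOver ℂ}

/-- **A conjugation-stable subspace of `Hᵏ(X(ℂ); ℂ)` is defined over `ℝ`**: `c ∈ S` iff
`re c ⊗ 1 ∈ S` and `im c ⊗ 1 ∈ S` (`2 (re c ⊗ 1) = c + c̄`, `2i (im c ⊗ 1) = c - c̄`,
`c = re c ⊗ 1 + i (im c ⊗ 1)`). [cite: VoisinHodgeI2002, §6.1.3 Cor. 6.12] -/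
theorem mem_iff_reClass_imClass_of_conjClass_mem {Y : Type} [TopologicalSpace Y] {k : ℕ}
    (S : Submodule ℂ (singularCohomology ℂ ℂ Y k)) (hS : ∀ c ∈ S, conjClass Y k c ∈ S)
    (c : singularCohomology ℂ ℂ Y k) :
    c ∈ S ↔ ofRealClass Y k (reClass Y k c) ∈ S ∧ ofRealClass Y k (imClass Y k c) ∈ S := by
  have hsum := ofRealClass_reClass_add_I_smul c
  have hconj := conjClass_eq_reClass_sub_imClass c
  have h2 : (2 : ℂ) • ofRealClass Y k (reClass Y k c) = c + conjClass Y k c :=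
    calc (2 : ℂ) • ofRealClass Y k (reClass Y k c)
        = (ofRealClass Y k (reClass Y k c) + Complex.I • ofRealClass Y k (imClass Y k c)) +
            (ofRealClass Y k (reClass Y k c) - Complex.I • ofRealClass Y k (imClass Y k c)) := by
          rw [two_smul]; abel
      _ = c + conjClass Y k c := by rw [hsum, ← hconj]
  have h3 : (2 * Complex.I) • ofRealClass Y k (imClass Y k c) = c - conjClass Y k c :=
    calc (2 * Complex.I) • ofRealClass Y k (imClass Y k c)
        = (ofRealClass Y k (reClass Y k c) + Complex.I • ofRealClass Y k (imClass Y k c)) -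
            (ofRealClass Y k (reClass Y k c) - Complex.I • ofRealClass Y k (imClass Y k c)) := by
          rw [mul_smul, two_smul]; abel
      _ = c - conjClass Y k c := by rw [hsum, ← hconj]
  constructor
  · intro hc
    have hcbar := hS c hc
    have hre : ofRealClass Y k (reClass Y k c) = (2⁻¹ : ℂ) • (c + conjClass Y k c) := by
      rw [← h2, smul_smul, inv_mul_cancel₀ two_ne_zero, one_smul]
    have him : ofRealClass Y k (imClass Y k c) = (2 * Complex.I)⁻¹ • (c - conjClass Y k c) := by
      rw [← h3, smul_smul, inv_mul_cancel₀ (mul_ne_zero two_ne_zero Complex.I_ne_zero), one_smul]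
    refine ⟨?_, ?_⟩
    · rw [hre]; exact S.smul_mem _ (S.add_mem hc hcbar)
    · rw [him]; exact S.smul_mem _ (S.sub_mem hc hcbar)
  · rintro ⟨hre, him⟩
    rw [← hsum]
    exact S.add_mem hre (S.smul_mem _ him)

/-- **`dim_ℝ S_ℝ = dim_ℂ S`** for a conjugation-stable `ℂ`-subspace `S ⊆ Hᵏ(X; ℂ)` and its real form
`S_ℝ = {y | y ⊗ 1 ∈ S}` (any real subspace with this membership). [cite: VoisinHodgeI2002, §6.1.3 Cor. 6.12] -/
theorem finrank_real_eq_of_conjClass_mem {Y : Type} [TopologicalSpace Y] {k : ℕ}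
    [FiniteDimensional ℝ (singularCohomology ℝ ℝ Y k)]
    (S : Submodule ℂ (singularCohomology ℂ ℂ Y k)) (hS : ∀ c ∈ S, conjClass Y k c ∈ S)
    (U : Submodule ℝ (singularCohomology ℝ ℝ Y k)) (hU : ∀ y, y ∈ U ↔ ofRealClass Y k y ∈ S) :
    Module.finrank ℝ U = Module.finrank ℂ S := by
  refine Deligne1982.finrank_real_eq_finrank_complex_of_forall_mem_iff U S (fun c ↦ ?_)
  rw [hU, hU]
  exact mem_iff_reClass_imClass_of_conjClass_mem S hS c

/-- The type piece `(p, p)` is conjugation-stable (`conj H^{p,p} = H^{p,p}`). [cite: VoisinHodgeI2002, §6.1.3 Cor. 6.12] -/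
theorem HodgeModel.conjClass_mem_typePiece_self (hX : IsSmoothProjective n X) (A : HodgeModel n X)
    {k p : ℕ} (hpp : (p, p) ∈ Finset.HasAntidiagonal.antidiagonal k) {c : complexBetti X k}
    (hc : c ∈ A.typePiece k ⟨(p, p), hpp⟩) :
    conjClass (Motives.ComplexPoints X) k c ∈ A.typePiece k ⟨(p, p), hpp⟩ := by
  rw [A.mem_typePiece_iff_isOfHodgeType' hX] at hc ⊢
  exact hc.conjClass hX

/-- The sum `H^{p,q} ⊕ H^{q,p}` of two conjugate type pieces is conjugation-stable.
[cite: VoisinHodgeI2002, §6.1.3 Cor. 6.12] -/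
theorem HodgeModel.conjClass_mem_typePiece_sup (hX : IsSmoothProjective n X) (A : HodgeModel n X)
    {k p q : ℕ} (hpq : (p, q) ∈ Finset.HasAntidiagonal.antidiagonal k)
    (hqp : (q, p) ∈ Finset.HasAntidiagonal.antidiagonal k) {c : complexBetti X k}
    (hc : c ∈ A.typePiece k ⟨(p, q), hpq⟩ ⊔ A.typePiece k ⟨(q, p), hqp⟩) :
    conjClass (Motives.ComplexPoints X) k c ∈ A.typePiece k ⟨(p, q), hpq⟩ ⊔ A.typePiece k ⟨(q, p), hqp⟩ := by
  obtain ⟨a, ha, b, hb, rfl⟩ := Submodule.mem_sup.1 hc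
  rw [A.mem_typePiece_iff_isOfHodgeType' hX] at ha hb
  rw [conjClass_add]
  refine Submodule.add_mem _ (Submodule.mem_sup_right ?_) (Submodule.mem_sup_left ?_)
  · rw [A.mem_typePiece_iff_isOfHodgeType' hX]
    exact ha.conjClass hX
  · rw [A.mem_typePiece_iff_isOfHodgeType' hX]
    exact hb.conjClass hX

/-- **`dim_ℝ H^{p,p}_ℝ = h^{p,p}`**: a real subspace `U ⊆ Hᵏ(X(ℂ); ℝ)` consisting exactly of the classes
whose complexification is of type `(p, p)` has real dimension the Hodge number `h^{p,p}` (dimension of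
the type piece `(p,p)` of any Hodge model). [cite: VoisinHodgeI2002, §6.1.3 Cor. 6.12–6.13] -/
theorem finrank_real_eq_hodgeNumber_self (hX : IsSmoothProjective n X) {k p : ℕ}
    (hpp : (p, p) ∈ Finset.HasAntidiagonal.antidiagonal k)
    (U : Submodule ℝ (singularCohomology ℝ ℝ (Motives.ComplexPoints X) k))
    (hU : ∀ y, y ∈ U ↔ IsOfHodgeType n X k p p (ofRealClass _ k y)) (A : HodgeModel n X) :
    Module.finrank ℝ U = Module.finrank ℂ (A.typePiece k ⟨(p, p), hpp⟩) := by
  letI := hX.chartedSpace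
  haveI := Motives.ComplexPoints.compactSpace_of_isSmoothProjective hX
  haveI := Motives.ComplexPoints.t2Space_of_isSmoothProjective hX
  haveI : Module.Finite ℝ (singularCohomology ℝ ℝ (Motives.ComplexPoints X) k) :=
    finite_singularCohomology_of_compact_chartedSpace ℝ ℝ (d := 2 * n) k
  refine finrank_real_eq_of_conjClass_mem _ (fun c hc ↦ A.conjClass_mem_typePiece_self hX hpp hc) U
    (fun y ↦ ?_)
  rw [hU, A.mem_typePiece_iff_isOfHodgeType' hX]

/-- **`dim_ℝ (H^{p,q} ⊕ H^{q,p})_ℝ = 2 h^{p,q}`** for `p ≠ q`: a real subspace `U ⊆ Hᵏ(X(ℂ); ℝ)`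
consisting exactly of the classes whose complexification lies in `H^{p,q} ⊕ H^{q,p}` has real dimension
`2 h^{p,q}` (the two pieces are independent summands of the Hodge decomposition, and `h^{q,p} = h^{p,q}`
by Hodge symmetry). [cite: VoisinHodgeI2002, §6.1.3 Cor. 6.12–6.13] -/
theorem finrank_real_eq_two_mul_hodgeNumber (hX : IsSmoothProjective n X) (A : HodgeModel n X)
    {k p q : ℕ} (hne : p ≠ q) (hpq : (p, q) ∈ Finset.HasAntidiagonal.antidiagonal k)
    (hqp : (q, p) ∈ Finset.HasAntidiagonal.antidiagonal k)
    (U : Submodule ℝ (singularCohomology ℝ ℝ (Motives.ComplexPoints X) k))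
    (hU : ∀ y, y ∈ U ↔
      ofRealClass _ k y ∈ A.typePiece k ⟨(p, q), hpq⟩ ⊔ A.typePiece k ⟨(q, p), hqp⟩) :
    Module.finrank ℝ U = 2 * Module.finrank ℂ (A.typePiece k ⟨(p, q), hpq⟩) := by
  classical
  letI := hX.chartedSpace
  haveI := Motives.ComplexPoints.compactSpace_of_isSmoothProjective hX
  haveI := Motives.ComplexPoints.t2Space_of_isSmoothProjective hX
  haveI : Module.Finite ℝ (singularCohomology ℝ ℝ (Motives.ComplexPoints X) k) :=
    finite_singularCohomology_of_compact_chartedSpace ℝ ℝ (d := 2 * n) k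
  haveI : Module.Finite ℂ (complexBetti X k) :=
    finite_singularCohomology_of_compact_chartedSpace ℂ ℂ (d := 2 * n) k
  rw [finrank_real_eq_of_conjClass_mem _ (fun c hc ↦ A.conjClass_mem_typePiece_sup hX hpq hqp hc) U hU]
  -- the two pieces are disjoint summands of the Hodge decomposition
  have hdisj : A.typePiece k ⟨(p, q), hpq⟩ ⊓ A.typePiece k ⟨(q, p), hqp⟩ = ⊥ := by
    have hij : (⟨(p, q), hpq⟩ : ↥(Finset.HasAntidiagonal.antidiagonal k)) ≠ ⟨(q, p), hqp⟩ := by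
      intro h
      have h' := congrArg (fun x : ↥(Finset.HasAntidiagonal.antidiagonal k) ↦ x.1.1) h
      exact hne h'
    exact ((A.isInternal_typePiece k).submodule_iSupIndep.pairwiseDisjoint hij).eq_bot
  have hsum : Module.finrank ℂ ↥(A.typePiece k ⟨(p, q), hpq⟩ ⊔ A.typePiece k ⟨(q, p), hqp⟩) =
      Module.finrank ℂ (A.typePiece k ⟨(p, q), hpq⟩) + Module.finrank ℂ (A.typePiece k ⟨(q, p), hqp⟩) := by
    have h := Submodule.finrank_sup_add_finrank_inf_eq (A.typePiece k ⟨(p, q), hpq⟩)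
      (A.typePiece k ⟨(q, p), hqp⟩)
    rw [hdisj, finrank_bot, add_zero] at h
    exact h
  -- Hodge symmetry `h^{q,p} = h^{p,q}`
  have hsymm : Module.finrank ℂ (A.typePiece k ⟨(q, p), hqp⟩) =
      Module.finrank ℂ (A.typePiece k ⟨(p, q), hpq⟩) := by
    rw [A.finrank_typePiece_eq_finrank_hodgePQ hpq, A.finrank_typePiece_eq_finrank_hodgePQ hqp]
    exact (A.finrank_hodgePQ_symm hX (Finset.HasAntidiagonal.mem_antidiagonal.1 hpq)).symm
  rw [hsum, hsymm]
  ring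

/-! ### Orthogonality of the real Hodge blocks under the cup-product pairing in the middle degree -/

/-- **`H^{p,q} ⌣ H^{p',q'} = 0` in `H²ⁿ(X(ℂ); ℂ)` unless `(p', q') = (q, p)`** (middle degree
`p + q = n = p' + q'`): the product has type `(p + p', q + q')` (`cupPreservesHodgeType`) and
`p + p' > n` or `q + q' > n` (Voisin I Lemma 7.30: "the forms of degree `2n` are necessarily of
bidegree `(n,n)`"). [cite: VoisinHodgeI2002, §7.1.2 and Lemma 7.30] -/
theorem cupProduct_eq_zero_of_types_middle (hX : IsSmoothProjective n X) {p q p' q' : ℕ}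
    {a b : complexBetti X n} (ha : IsOfHodgeType n X n p q a) (hb : IsOfHodgeType n X n p' q' b)
    (hpq : p + q = n) (hp'q' : p' + q' = n) (hne : (p', q') ≠ (q, p)) {N : ℕ} (h : n + n = N) :
    cupProduct h a b = 0 := by
  have hab : IsOfHodgeType n X N (p + p') (q + q') (cupProduct h a b) :=
    BettiUniverse.cupPreservesHodgeType exists_isReal_hodgeModel_holds
      hodgePQ_independent_of_hodgeModel_holds hX h ha hb
  refine hab.eq_zero_of_lt hX ?_
  by_contra hcon
  push Not at hcon
  apply hne
  exact Prod.ext (by simp only; omega) (by simp only; omega)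

/-- **The blocks `H^{p,q} ⊕ H^{q,p}` are mutually orthogonal for the cup product to the top degree**:
`a ∈ H^{p,q} ⊕ H^{q,p}`, `b ∈ H^{p',q'} ⊕ H^{q',p'}` with `{p', q'} ≠ {p, q}` (as unordered pairs,
all in the middle degree `n`) give `a ⌣ b = 0`. [cite: VoisinHodgeI2002, §7.1.2 and §6.3.2 (proof of Thm. 6.33)] -/
theorem cupProduct_eq_zero_of_mem_typePiece_sup (hX : IsSmoothProjective n X) (A : HodgeModel n X)
    {p q p' q' : ℕ} (hpq : (p, q) ∈ Finset.HasAntidiagonal.antidiagonal n)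
    (hqp : (q, p) ∈ Finset.HasAntidiagonal.antidiagonal n)
    (hp'q' : (p', q') ∈ Finset.HasAntidiagonal.antidiagonal n)
    (hq'p' : (q', p') ∈ Finset.HasAntidiagonal.antidiagonal n)
    (hne : (p', q') ≠ (q, p)) (hne' : (p', q') ≠ (p, q))
    {a b : complexBetti X n} (ha : a ∈ A.typePiece n ⟨(p, q), hpq⟩ ⊔ A.typePiece n ⟨(q, p), hqp⟩)
    (hb : b ∈ A.typePiece n ⟨(p', q'), hp'q'⟩ ⊔ A.typePiece n ⟨(q', p'), hq'p'⟩) {N : ℕ} (h : n + n = N) :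
    cupProduct h a b = 0 := by
  have hs : p + q = n := Finset.HasAntidiagonal.mem_antidiagonal.1 hpq
  have hs' : p' + q' = n := Finset.HasAntidiagonal.mem_antidiagonal.1 hp'q'
  obtain ⟨a₁, ha₁, a₂, ha₂, rfl⟩ := Submodule.mem_sup.1 ha
  obtain ⟨b₁, hb₁, b₂, hb₂, rfl⟩ := Submodule.mem_sup.1 hb
  rw [A.mem_typePiece_iff_isOfHodgeType' hX] at ha₁ ha₂ hb₁ hb₂
  have ha₁' : IsOfHodgeType n X n p q a₁ := ha₁
  have ha₂' : IsOfHodgeType n X n q p a₂ := ha₂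
  have hb₁' : IsOfHodgeType n X n p' q' b₁ := hb₁
  have hb₂' : IsOfHodgeType n X n q' p' b₂ := hb₂
  have hne₂ : (q', p') ≠ (q, p) := fun e ↦ hne' (Prod.ext (congrArg Prod.snd e) (congrArg Prod.fst e))
  have hne₃ : (p', q') ≠ (p, q) := hne'
  have hne₄ : (q', p') ≠ (p, q) := fun e ↦ hne (Prod.ext (congrArg Prod.snd e) (congrArg Prod.fst e))
  have h₁ := cupProduct_eq_zero_of_types_middle hX ha₁' hb₁' hs hs' hne h
  have h₂ := cupProduct_eq_zero_of_types_middle hX ha₁' hb₂' hs (by omega) hne₂ h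
  have h₃ := cupProduct_eq_zero_of_types_middle hX ha₂' hb₁' (by omega) hs' hne₃ h
  have h₄ := cupProduct_eq_zero_of_types_middle hX ha₂' hb₂' (by omega) (by omega) hne₄ h
  rw [LinearMap.map_add₂, map_add, map_add, h₁, h₂, h₃, h₄, add_zero, add_zero]

/-- **The real Hodge blocks are mutually orthogonal for the real cup pairing** `(x, y) ↦ x ⌣ y ∈
H²ⁿ(X(ℂ); ℝ)` (hence for `⟨x ⌣ y, [X(ℂ)]_μ ⊗ 1⟩`): real classes `x, y ∈ Hⁿ(X(ℂ); ℝ)` with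
`x ⊗ 1 ∈ H^{p,q} ⊕ H^{q,p}`, `y ⊗ 1 ∈ H^{p',q'} ⊕ H^{q',p'}`, `{p', q'} ≠ {p, q}`, have `x ⌣ y = 0` — the
orthogonality of the blocks in the proof of Voisin I Thm. 6.33. [cite: VoisinHodgeI2002, §6.3.2 Thm. 6.33 (proof)] -/
theorem cupProduct_real_eq_zero_of_mem_typePiece_sup (hX : IsSmoothProjective n X) (A : HodgeModel n X)
    {p q p' q' : ℕ} (hpq : (p, q) ∈ Finset.HasAntidiagonal.antidiagonal n)
    (hqp : (q, p) ∈ Finset.HasAntidiagonal.antidiagonal n)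
    (hp'q' : (p', q') ∈ Finset.HasAntidiagonal.antidiagonal n)
    (hq'p' : (q', p') ∈ Finset.HasAntidiagonal.antidiagonal n)
    (hne : (p', q') ≠ (q, p)) (hne' : (p', q') ≠ (p, q))
    {x y : singularCohomology ℝ ℝ (Motives.ComplexPoints X) n}
    (hx : ofRealClass _ n x ∈ A.typePiece n ⟨(p, q), hpq⟩ ⊔ A.typePiece n ⟨(q, p), hqp⟩)
    (hy : ofRealClass _ n y ∈ A.typePiece n ⟨(p', q'), hp'q'⟩ ⊔ A.typePiece n ⟨(q', p'), hq'p'⟩)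
    {N : ℕ} (h : n + n = N) :
    cupProduct h x y = 0 := by
  apply ofRealClass_injective N
  rw [ofRealClass_cupProduct, map_zero]
  exact cupProduct_eq_zero_of_mem_typePiece_sup hX A hpq hqp hp'q' hq'p' hne hne' hx hy h

end RealPieces

end Literature.AlgebraicGeometry.HodgeTheory

end
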